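import Mathlib.Data.Nat.Pairing
import Literature.Computability.Complexity.ListBricks
import Literature.Computability.Complexity.FoldBricks
import Literature.Computability.Complexity.UnaryBricks
import Literature.Computability.Complexity.PlumbingBricks
import Literature.Computability.Complexity.FPStringBricks
import Literature.Computability.Complexity.HashBricks
import HarnessLib

/-!
# Complexity meta: unary parameter bricks for the scheme of Thm. 8.9 (Hirahara 2021)

Topic `Literature/Computability/MetaComplexity`. `FP` string functions (in the tree's brick algebra:
`fanoutFn`, `iteFn`, `Brick.loopX`, `umulFn`, `logFn`, `Plumb.polyFn`, …) computing, on unary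
arguments, the parameters of the checker and solver of the proof of Thm. 8.9 of S. Hirahara,
*Average-case hardness of NP from exponential worst-case hardness assumptions* (STOC 2021; ECCC
TR21-058, pp. 41–42), as fixed in `UPSearchScheme.lean`:

* `pairUF ⟨1ᵃ, 1ᵇ⟩ = 1^{Nat.pair a b}` and `idx4UF ⟨1ⁿ, ⟨1ᵏ, ⟨1ᵗ, 1ˢ⟩⟩⟩ = 1^{⟨n,k,t,s⟩}` (the index
  of the language ensemble `L'`, Mathlib's pairing function nested);
* `lamUF c 1ᵗ = 1^{c (log (t+2) + 1)}` (the slack `Λ(t)` of `k' = k + Λ(t)`);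
* `pow2CapF ⟨1ᵉ, cap⟩ = 1^{min (2^e) |cap|}` (capped powers of two by a counted doubling loop — the
  solver's `1^{2^{k'}}`, polynomial because `2^{k'} ≤ 2^k · (2(t+2))^c`);
* `padCertUF ⟨1ᴺ, y⟩ = 1^{N-|y|} ‖ 0 ‖ y` (the fixed-length certificate padding `padCert`).

All semantics lemmas are stated on unary (all-`1`) numeric arguments, which is how the bricks are
fed. [Arora–Barak 2009, §1.3 (polynomial-time closure under composition and bounded loops)]

## References

* S. Hirahara, ECCC TR21-058, proof of Thm. 8.9 (the checker `C` and the solver `S`), pp. 41–42.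
* S. Arora, B. Barak, *Computational Complexity: A Modern Approach*, CUP 2009, §1.3.
-/

namespace Literature.Computability.MetaComplexity

open _root_.Computability Complexity Brick Plumb HashBricks Polynomial

/-! ### Pairing in unary -/

/-- **`pairUF ⟨1ᵃ, 1ᵇ⟩ = 1^{Nat.pair a b}`**: `Nat.pair a b = if a < b then b² + a else a² + a + b`,
with the unary comparison `ltLenF`, multiplication `umulFn` and concatenation. [folklore] -/
noncomputable def pairUF : List Bool → List Bool :=
  iteFn ltLenF (fun z => (umulFn ∘ fanoutFn sndF sndF) z ++ fstF z)
    (fun z => (umulFn ∘ fanoutFn fstF fstF) z ++ fstF z ++ sndF z)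

/-- `pairUF ⟨1ᵃ, 1ᵇ⟩ = 1^{Nat.pair a b}`. [folklore] -/
@[simp] theorem pairUF_boolPair (a b : ℕ) : pairUF (boolPair (ones a) (ones b)) = ones (Nat.pair a b) := by
  unfold pairUF Nat.pair
  by_cases h : a < b
  · rw [iteFn_apply_true (by simp [h]), if_pos h]
    simp [ones, fanoutFn_apply]
  · rw [iteFn_apply_false (by simp [h]), if_neg h]
    simp [ones, fanoutFn_apply, Nat.add_assoc]

/-- `pairUF ∈ FP`. [folklore] -/
theorem pairUF_mem_FP : pairUF ∈ FP := by
  unfold pairUF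
  exact iteFn_mem_FP ltLenF_mem_FP
    (append_mem_FP (comp_mem_FP umulFn_mem_FP (fanoutFn_mem_FP sndF_mem_FP sndF_mem_FP)) fstF_mem_FP)
    (append_mem_FP (append_mem_FP (comp_mem_FP umulFn_mem_FP (fanoutFn_mem_FP fstF_mem_FP fstF_mem_FP))
      fstF_mem_FP) sndF_mem_FP)

/-- **`idx4UF ⟨1ⁿ, ⟨1ᵏ, ⟨1ᵗ, 1ˢ⟩⟩⟩ = 1^{⟨n, k, t, s⟩}`** with `⟨n,k,t,s⟩ = pair n (pair k (pair t s))`.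
[folklore] -/
noncomputable def idx4UF : List Bool → List Bool :=
  pairUF ∘ fanoutFn (nthF 0) (pairUF ∘ fanoutFn (nthF 1) (pairUF ∘ fanoutFn (nthF 2) (sndPow 2)))

/-- Semantics of `idx4UF`. [folklore] -/
@[simp] theorem idx4UF_apply (n k t s : ℕ) :
    idx4UF (boolPair (ones n) (boolPair (ones k) (boolPair (ones t) (ones s)))) =
      ones (Nat.pair n (Nat.pair k (Nat.pair t s))) := by
  simp [idx4UF, fanoutFn_apply]

/-- `idx4UF ∈ FP`. [folklore] -/
theorem idx4UF_mem_FP : idx4UF ∈ FP := by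
  unfold idx4UF
  exact comp_mem_FP pairUF_mem_FP (fanoutFn_mem_FP (nthF_mem_FP 0) (comp_mem_FP pairUF_mem_FP
    (fanoutFn_mem_FP (nthF_mem_FP 1) (comp_mem_FP pairUF_mem_FP (fanoutFn_mem_FP (nthF_mem_FP 2) (sndPow_mem_FP 2))))))

/-! ### The slack `Λ(t) = c (log (t+2) + 1)` -/

/-- **`lamUF c 1ᵗ = 1^{c (log (t+2) + 1)}`**: two extra `1`s, `logFn`, one more `1`, times `c`.
[Hirahara 2021 (ECCC TR21-058), proof of Claim 8.10 (`k' := k + O(log t)`)] [folklore] -/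
noncomputable def lamUF (c : ℕ) : List Bool → List Bool :=
  umulFn ∘ fanoutFn (fun _ => ones c) (List.cons true ∘ logFn ∘ fun u => u ++ [true, true])

/-- Semantics of `lamUF`. [folklore] -/
@[simp] theorem lamUF_apply (c t : ℕ) : lamUF c (ones t) = ones (c * (Nat.log 2 (t + 2) + 1)) := by
  have h : logFn (ones t ++ [true, true]) = ones (Nat.log 2 (t + 2)) := by
    simp [logFn, ones]
  simp only [lamUF, Function.comp_apply, fanoutFn_apply, h]
  rw [show true :: ones (Nat.log 2 (t + 2)) = ones (Nat.log 2 (t + 2) + 1) by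
    simp [ones, List.replicate_succ], umulFn_boolPair]

/-- `lamUF c ∈ FP`. [folklore] -/
theorem lamUF_mem_FP (c : ℕ) : lamUF c ∈ FP := by
  unfold lamUF
  exact comp_mem_FP umulFn_mem_FP (fanoutFn_mem_FP (const_mem_FP _)
    (comp_mem_FP (cons_mem_FP true) (comp_mem_FP logFn_mem_FP (append_mem_FP OracleCompose.id_mem_FP (const_mem_FP _)))))

/-! ### Capped powers of two -/

/-- One doubling, truncated to the yardstick: state `u ↦ (u ‖ u) ↾ |cap|` (as a function of the loop
record `⟨cap, ⟨cnt, u⟩⟩`). [folklore] -/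
noncomputable def dblBody : List Bool → List Bool :=
  takeFn ∘ fanoutFn (nthF 0) (fun z => sndPow 1 z ++ sndPow 1 z)

/-- **`pow2CapF ⟨1ᵉ, cap⟩ = 1^{min (2^e) |cap|}`**: `|cap|` rounds over the yardstick `cap`, of which
the counter `bin e` activates `min e |cap|`, each doubling the state and truncating it to `|cap|`;
the initial state is `1 ↾ |cap|`. [Arora–Barak 2009, §1.3 (bounded loops)] [folklore] -/
noncomputable def pow2CapF : List Bool → List Bool :=
  sndPow 1 ∘ loopX dblBody ∘
    fanoutFn sndF (fanoutFn (lenBinF ∘ fstF) (takeFn ∘ fanoutFn sndF (fun _ => [true])))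

/-- The doubling step on a state `1^{min (2^i) C}` (any counter). [folklore] -/
theorem dblBody_record (cap c : List Bool) (i : ℕ) :
    dblBody (boolPair cap (boolPair c (ones (min (2 ^ i) cap.length)))) = ones (min (2 ^ (i + 1)) cap.length) := by
  simp only [dblBody, Function.comp_apply, fanoutFn_apply, nthF_zero_boolPair, sndPow_succ_boolPair,
    sndPow_zero_boolPair, takeFn_boolPair]
  rw [show ones (min (2 ^ i) cap.length) ++ ones (min (2 ^ i) cap.length) =
      ones (min (2 ^ i) cap.length + min (2 ^ i) cap.length) by simp [ones]]
  simp only [ones, List.take_replicate]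
  congr 1
  rw [pow_succ]
  omega

/-- The doubling loop from `1^{min (2^i) C}` reaches `1^{min (2^{i+r}) C}` after `r` active rounds
(counter `≤` number of rounds). [folklore] -/
theorem loopModel_dblBody (cap : List Bool) : ∀ r i : ℕ,
    loopModel dblBody cap r (ones (min (2 ^ i) cap.length)) = ones (min (2 ^ (i + r)) cap.length)
  | 0, i => by simp [loopModel]
  | r + 1, i => by
    rw [loopModel, dblBody_record, loopModel_dblBody cap r (i + 1), Nat.add_right_comm, Nat.add_assoc]

/-- The same when the counter exceeds the number of rounds (all rounds active). [folklore] -/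
theorem loopRun_dblBody (cap : List Bool) : ∀ n k i : ℕ, n ≤ k →
    loopRun dblBody cap (encodeNat k) n (ones (min (2 ^ i) cap.length)) = ones (min (2 ^ (i + n)) cap.length)
  | 0, k, i, _ => by simp [loopRun]
  | n + 1, k, i, h => by
    rw [loopRun, if_neg (encodeNat_ne_nil_of_pos (by omega)), bitsToNat_encodeNat, dblBody_record,
      loopRun_dblBody cap n (k - 1) (i + 1) (by omega), Nat.add_right_comm, Nat.add_assoc]

/-- Semantics of `pow2CapF`. [folklore] -/
@[simp] theorem pow2CapF_boolPair (e : ℕ) (cap : List Bool) :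
    pow2CapF (boolPair (ones e) cap) = ones (min (2 ^ e) cap.length) := by
  have hini : [true].take cap.length = ones (min (2 ^ 0) cap.length) := by
    cases cap <;> simp [ones]
  simp only [pow2CapF, Function.comp_apply, fanoutFn_apply, sndF_boolPair, fstF_boolPair, lenBinF_apply,
    takeFn_boolPair, hini]
  rw [show (ones e).length = e by simp [ones], sndPow_one_loopX_record]
  rcases le_total e cap.length with hle | hle
  · rw [loopRun_encodeNat dblBody cap e cap.length _ hle, loopModel_dblBody, Nat.zero_add]
  · rw [loopRun_dblBody cap cap.length e 0 hle, Nat.zero_add]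
    have h1 : cap.length ≤ 2 ^ cap.length := Nat.lt_two_pow_self.le
    have h2 : 2 ^ cap.length ≤ 2 ^ e := Nat.pow_le_pow_right two_pos hle
    rw [min_eq_right h1, min_eq_right (h1.trans h2)]

/-- `pow2CapF ∈ FP`. [folklore] -/
theorem pow2CapF_mem_FP : pow2CapF ∈ FP := by
  have hbody : dblBody ∈ FP := by
    unfold dblBody
    exact comp_mem_FP takeFn_mem_FP (fanoutFn_mem_FP (nthF_mem_FP 0)
      (append_mem_FP (sndPow_mem_FP 1) (sndPow_mem_FP 1)))
  have hgrowth : ∀ z, (dblBody z).length ≤ (sndPow 1 z).length + (X : Polynomial ℕ).eval (fstF z).length := by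
    intro z
    simp only [dblBody, Function.comp_apply, fanoutFn_apply, takeFn_boolPair, eval_X, nthF_zero]
    exact (List.length_take_le _ _).trans (Nat.le_add_left _ _)
  unfold pow2CapF
  exact comp_mem_FP (sndPow_mem_FP 1) (comp_mem_FP (loopX_mem_FP hbody hgrowth)
    (fanoutFn_mem_FP sndF_mem_FP (fanoutFn_mem_FP (comp_mem_FP lenBinF_mem_FP fstF_mem_FP)
      (comp_mem_FP takeFn_mem_FP (fanoutFn_mem_FP sndF_mem_FP (const_mem_FP _))))))

/-! ### Certificate padding -/

/-- **`padCertUF ⟨1ᴺ, y⟩ = 1^{N-|y|} ‖ 0 ‖ y`**: the `1`-block is `1ᴺ` with `|y|` symbols dropped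
(`dropFn`). [folklore] -/
noncomputable def padCertUF : List Bool → List Bool :=
  fun z => (dropFn ∘ fanoutFn sndF fstF) z ++ (List.cons false ∘ sndF) z

/-- Semantics of `padCertUF`. [folklore] -/
@[simp] theorem padCertUF_boolPair (N : ℕ) (y : List Bool) :
    padCertUF (boolPair (ones N) y) = ones (N - y.length) ++ false :: y := by
  simp [padCertUF, fanoutFn_apply, ones, List.drop_replicate]

/-- `padCertUF ∈ FP`. [folklore] -/
theorem padCertUF_mem_FP : padCertUF ∈ FP := by
  unfold padCertUF
  exact append_mem_FP (comp_mem_FP dropFn_mem_FP (fanoutFn_mem_FP sndF_mem_FP fstF_mem_FP))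
    (comp_mem_FP (cons_mem_FP false) sndF_mem_FP)

end Literature.Computability.MetaComplexity
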